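import Summits.Ventures.GridStability.Models.UniformDampingSpectrum
import Summits.Ventures.GridStability.Models.InverterNetwork

/-!
# GridStability/Models/InverterNetworkLinearisation — small-signal analysis of droop-inverter NETWORKS with a common power-filter time constant (uniform damping ratio): the linearisation decouples into quadratics over a symmetric pencil, for every `n`

Cell `gridfusion` (LADDER-GRIDFUSION, APEX LINE «inverter-dominated networks», rung G3 / wave-1
candidate row «G3-ss» (lead 02:39:27Z, certnum RQ-013); seat gridfusion-model-3 (g5)). MODEL-SIDE
input, network version of `Models/InverterLinearisation.lean` (p490298, the 2-state rows in closed
form). WHAT THIS FILE SHOWS (memo §1 «certifiable today» / §3 «levers and ceilings»): for the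
frozen-voltage droop microgrid `DroopMicrogrid.freqField` (model N2 = classical network-reduced swing
model `ClassicalSwing`, kernel identity `DroopMicrogrid.freqField_eq_field`, p464230) whose units share
ONE power-filter time constant `τ_Pi = τ` — equivalently a classical multimachine model with UNIFORM
damping ratio `D_i = d·M_i` — the Jacobian at any angle configuration `δ` is the block matrix
`J = [[0, 1], [−M⁻¹ L(δ), −d·1]]` with `L(δ) = ∂P_e/∂δ` (the synchronising-coefficient Laplacian,
SYMMETRIC for a lossless reciprocal network); with the linear algebra of `Models/UniformDampingSpectrum.lean`
(`secondOrderJac_eig_iff`: every mode is a root of `z² + d z + ν = 0` over a pencil eigenvalue `ν` of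
`L x = ν M x`; `pencil_eig_real_gt`: ONE `n × n` PSD certificate `L − ν₀ M + β (M1)(M1)ᵀ ≻ 0` makes every
non-synchronous `ν` real `> ν₀`):
* `ClassicalSwing.hasFDerivAt_field` — `J(δ)` IS the Fréchet derivative of the typed field at every state;
* `ClassicalSwing.eig_re_lt_neg_of_uniformDamping` / `DroopMicrogrid.eig_re_lt_neg_of_commonFilter` —
  `d > 2r`, `ν₀ > d r − r²` ⇒ every eigenvalue of `J(δ)` off the synchronous mode has `Re z < −r` (a
  certified DECAY RATE for an `n`-unit network from one exact PSD check and two scalar inequalities, no SDP);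
  `eig_re_eq_of_uniformDamping` — `ν₀ ≥ d²/4` ⇒ `Re z = −d/2` EXACTLY (underdamped regime);
  `eig_sync_of_uniformDamping` — the synchronous mode (`L(δ) x = 0`, rotational symmetry) has `z ∈ {0, −d}`.

LEVER (memo §3): uniform damping is GENERIC for droop microgrids (`D_i/M_i = 1/τ_Pi`, the filter
constant, p491021). CEILING: heterogeneous filters / the voltage loop (4c) / a GFL unit with a PLL break
the decoupling (then certnum's box tool RQ-013 or an LMI); lossy lines make `L(δ)` non-symmetric.

THREE COLUMNS. CERTIFIED (kernel, once instantiated): statements about the MATRIX `J` = Fréchet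
derivative of the typed vector field at the typed state («small-signal» = spectrum of `J`; meaning for
the linearised ODE: [cite: HairerNorsettWanner1993, §I.13 Theorem 13.1]); nothing is claimed about the
nonlinear flow (the -roa files' business). MODELLED: frozen-voltage lossless droop microgrid MV-6N +
MV-6D (network) [cite: KunduEtAl2019, eqs. (4a)–(4b), (5a)] [cite: SchifferEtAl2014, Remark 3.3], resp.
classical model MV-2L + MV-λ [cite: SauerPai1998, §6.10]. VALIDATED: nothing here. No sentence of this
file says a converter, a microgrid or a grid is stable. No parameter values (instances elsewhere).
-/

noncomputable section

open Real Matrix Finset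
open scoped ComplexOrder ComplexConjugate

namespace Summit.Ventures.GridStability.Models

/-! ## §1 The classical network-reduced model (= frozen-voltage droop microgrid): Jacobian and linearisation -/

namespace ClassicalSwing

variable {n : ℕ} (p : ClassicalSwing n)

/-- Synchronising coefficient of the ordered pair `(i, j)` at the angle configuration `δ`:
`a_ij(δ) = C_ij cos(δ_i − δ_j) − D_ij sin(δ_i − δ_j)` = `∂/∂δ_i` of the `(i, j)` flow term of `P_ei`
(Sauer–Pai (7.212)). [cite: SauerPai1998, §7.9.1 (7.212)–(7.214)] -/
def syncCoef (δ : Fin n → ℝ) (i j : Fin n) : ℝ :=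
  p.Ccoef i j * cos (δ i - δ j) - p.Dcoef i j * sin (δ i - δ j)

/-- **The matrix `L(δ) = ∂P_e/∂δ`** (diagonal `Σ_{k ≠ i} a_ik`, off-diagonal `−a_ij`): a weighted graph
Laplacian when the network is lossless and reciprocal (`PeJac_isSymm`, `PeJac_colsum`). [folklore] -/
def PeJac (δ : Fin n → ℝ) : Matrix (Fin n) (Fin n) ℝ := fun i j =>
  if j = i then ∑ k ∈ univ.erase i, p.syncCoef δ i k else -p.syncCoef δ i j

/-- `(L(δ) u)_i = Σ_{j ≠ i} a_ij (u_i − u_j)`. [folklore] -/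
theorem PeJac_mulVec (δ u : Fin n → ℝ) (i : Fin n) :
    (p.PeJac δ *ᵥ u) i = ∑ j ∈ univ.erase i, p.syncCoef δ i j * (u i - u j) := by
  simp only [Matrix.mulVec, dotProduct]
  rw [← Finset.add_sum_erase _ _ (Finset.mem_univ i)]
  have h1 : p.PeJac δ i i * u i = ∑ j ∈ univ.erase i, p.syncCoef δ i j * u i := by
    simp only [PeJac, if_true, Finset.sum_mul]
  have h2 : ∑ j ∈ univ.erase i, p.PeJac δ i j * u j = ∑ j ∈ univ.erase i, -(p.syncCoef δ i j * u j) := by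
    refine Finset.sum_congr rfl fun j hj => ?_
    simp only [PeJac, if_neg (Finset.ne_of_mem_erase hj), neg_mul]
  rw [h1, h2, ← Finset.sum_add_distrib]
  refine Finset.sum_congr rfl fun j _ => ?_
  ring

/-- LOSSLESS + RECIPROCAL (`G_ij = 0` off the diagonal, `B_ij = B_ji`) ⇒ `a_ij = a_ji`
(`= C_ij cos δ_ij`). [folklore] -/
theorem syncCoef_symm (hG : p.IsLossless) (hB : ∀ i j, p.B i j = p.B j i) (δ : Fin n → ℝ)
    {i j : Fin n} (hij : i ≠ j) : p.syncCoef δ i j = p.syncCoef δ j i := by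
  simp only [syncCoef, Ccoef, Dcoef, hG i j hij, hG j i hij.symm, hB i j, ← neg_sub (δ i) (δ j),
    cos_neg]
  ring

/-- Lossless + reciprocal ⇒ `L(δ)` is symmetric. [folklore] -/
theorem PeJac_isSymm (hG : p.IsLossless) (hB : ∀ i j, p.B i j = p.B j i) (δ : Fin n → ℝ) :
    (p.PeJac δ).IsSymm := by
  refine Matrix.IsSymm.ext fun i j => ?_
  by_cases hij : i = j
  · subst hij; rfl
  · simp only [PeJac, if_neg hij, if_neg (Ne.symm hij), p.syncCoef_symm hG hB δ (Ne.symm hij)]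

/-- Lossless + reciprocal ⇒ the columns of `L(δ)` sum to zero (`1ᵀ L = 0`; with symmetry `L 1 = 0`,
the rotational symmetry `P_e(δ + a·1) = P_e(δ)`). [folklore] -/
theorem PeJac_colsum (hG : p.IsLossless) (hB : ∀ i j, p.B i j = p.B j i) (δ : Fin n → ℝ)
    (j : Fin n) : ∑ i, p.PeJac δ i j = 0 := by
  rw [← Finset.add_sum_erase _ _ (Finset.mem_univ j)]
  have h1 : p.PeJac δ j j = ∑ k ∈ univ.erase j, p.syncCoef δ j k := by simp [PeJac]
  have h2 : ∑ i ∈ univ.erase j, p.PeJac δ i j = ∑ i ∈ univ.erase j, -p.syncCoef δ j i := by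
    refine Finset.sum_congr rfl fun i hi => ?_
    have hij : i ≠ j := Finset.ne_of_mem_erase hi
    simp only [PeJac, if_neg hij.symm, p.syncCoef_symm hG hB δ hij]
  rw [h1, h2, ← Finset.sum_add_distrib]
  simp

/-- The lower-left block of the Jacobian: `A(δ)_ij = L(δ)_ij / M_i` (`= M⁻¹ L(δ)`). [folklore] -/
def Ablock (δ : Fin n → ℝ) : Matrix (Fin n) (Fin n) ℝ := fun i j => (p.M i)⁻¹ * p.PeJac δ i j

/-- **The Jacobian matrix of the classical model at a state with angles `δ`** (it does not depend on
the speeds), on `Fin n ⊕ Fin n` (angles, speed deviations):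
`J(δ) = [[0, 1], [−M⁻¹ L(δ), −diag(D_i/M_i)]]`. [folklore] -/
def jacMatrix (δ : Fin n → ℝ) : Matrix (Fin n ⊕ Fin n) (Fin n ⊕ Fin n) ℝ :=
  Matrix.fromBlocks 0 1 (-p.Ablock δ) (-Matrix.diagonal fun i => p.D i / p.M i)

/-- **Uniform damping ratio `D_i = d·M_i` ⇒ `J(δ) = J(M⁻¹L(δ), d)`** (`secondOrderJac`).
[cite: SauerPai1998, §6.10] -/
theorem jacMatrix_eq_secondOrderJac {d : ℝ} (hD : ∀ i, p.D i = d * p.M i) (hM : ∀ i, p.M i ≠ 0)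
    (δ : Fin n → ℝ) : p.jacMatrix δ = secondOrderJac (p.Ablock δ) d := by
  unfold jacMatrix secondOrderJac
  congr 1
  ext i j
  by_cases hij : i = j
  · subst hij
    simp only [Matrix.neg_apply, Matrix.diagonal_apply_eq, Matrix.smul_apply, Matrix.one_apply_eq,
      smul_eq_mul, mul_one, hD i]
    field_simp [hM i]
  · simp [Matrix.diagonal_apply_ne _ hij, Matrix.one_apply_ne hij]

/-- The line-angle functional `π_ij(u, w) = u_i − u_j` on the state space. [folklore] -/
def lineCLM (i j : Fin n) : State n →L[ℝ] ℝ :=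
  (ContinuousLinearMap.proj (R := ℝ) (φ := fun _ : Fin n => ℝ) i
      - ContinuousLinearMap.proj (R := ℝ) (φ := fun _ : Fin n => ℝ) j).comp
    (ContinuousLinearMap.fst ℝ (Fin n → ℝ) (Fin n → ℝ))

/-- The speed-coordinate functional `(u, w) ↦ w_i` on the state space. [folklore] -/
def speedCLM (i : Fin n) : State n →L[ℝ] ℝ :=
  (ContinuousLinearMap.proj (R := ℝ) (φ := fun _ : Fin n => ℝ) i).comp
    (ContinuousLinearMap.snd ℝ (Fin n → ℝ) (Fin n → ℝ))

/-- `π_ij(u, w) = u_i − u_j`. [folklore] -/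
@[simp] theorem lineCLM_apply (i j : Fin n) (v : State n) : lineCLM i j v = v.1 i - v.1 j := by
  simp [lineCLM]

/-- `speedCLM i (u, w) = w_i`. [folklore] -/
@[simp] theorem speedCLM_apply (i : Fin n) (v : State n) : speedCLM i v = v.2 i := by
  simp [speedCLM]

/-- Derivative of `P_ei` at `δ` as a continuous linear functional on the state space
(`Σ_{j ≠ i} (C_ij cos δ_ij · π_ij + D_ij (−sin δ_ij) · π_ij)`, `π_ij(u, w) = u_i − u_j`). [folklore] -/
def PeFDeriv (δ : Fin n → ℝ) (i : Fin n) : State n →L[ℝ] ℝ :=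
  ∑ j ∈ univ.erase i,
    (p.Ccoef i j • (cos (δ i - δ j) • lineCLM i j) + p.Dcoef i j • ((-sin (δ i - δ j)) • lineCLM i j))

/-- `PeFDeriv δ i (u, w) = (L(δ) u)_i`. [folklore] -/
theorem PeFDeriv_apply (δ : Fin n → ℝ) (i : Fin n) (v : State n) :
    p.PeFDeriv δ i v = (p.PeJac δ *ᵥ v.1) i := by
  rw [PeJac_mulVec]
  simp only [PeFDeriv, FunLike.coe_sum, Finset.sum_apply, _root_.add_apply, _root_.smul_apply,
    lineCLM_apply, smul_eq_mul, syncCoef]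
  refine Finset.sum_congr rfl fun j _ => ?_
  ring

/-- **The Jacobian as a continuous linear map on the state space** `(δ, ω)`:
`(u, w) ↦ (w, (−L(δ) u − D ∘ w) / M)`. [folklore] -/
def jacCLM (δ : Fin n → ℝ) : State n →L[ℝ] State n :=
  (ContinuousLinearMap.snd ℝ (Fin n → ℝ) (Fin n → ℝ)).prod
    (ContinuousLinearMap.pi fun i => (-(p.M i)⁻¹) • (p.PeFDeriv δ i + p.D i • speedCLM i))

/-- `jacCLM δ (u, w) = (w, ((−(L(δ) u)_i − D_i w_i)/M_i)_i)`. [folklore] -/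
theorem jacCLM_apply (δ : Fin n → ℝ) (v : State n) :
    p.jacCLM δ v = (v.2, fun i => (-(p.PeJac δ *ᵥ v.1) i - p.D i * v.2 i) / p.M i) := by
  refine Prod.ext ?_ ?_
  · simp [jacCLM]
  · funext i
    simp only [jacCLM, ContinuousLinearMap.prod_apply, ContinuousLinearMap.pi_apply,
      _root_.smul_apply, _root_.add_apply, PeFDeriv_apply, speedCLM_apply, smul_eq_mul]
    ring

/-- **`jacCLM` IS the block matrix `jacMatrix`** acting on `[u; w]`. [folklore] -/
theorem jacCLM_eq_mulVec (δ : Fin n → ℝ) (v : State n) :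
    p.jacCLM δ v = (fun i => (p.jacMatrix δ *ᵥ Sum.elim v.1 v.2) (Sum.inl i),
      fun i => (p.jacMatrix δ *ᵥ Sum.elim v.1 v.2) (Sum.inr i)) := by
  rw [jacCLM_apply, jacMatrix, Matrix.fromBlocks_mulVec]
  refine Prod.ext ?_ ?_
  · funext i
    simp
  · funext i
    simp only [Sum.elim_inr, Pi.add_apply, Matrix.neg_mulVec, Pi.neg_apply, Matrix.mulVec_diagonal,
      Sum.elim_comp_inl, Sum.elim_comp_inr]
    have : (p.Ablock δ *ᵥ v.1) i = (p.M i)⁻¹ * (p.PeJac δ *ᵥ v.1) i := by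
      simp only [Matrix.mulVec, dotProduct, Ablock, Finset.mul_sum, mul_assoc]
    rw [this]
    ring

/-- **Linearisation (kernel fact): the classical network-reduced field `M_cl` is Fréchet differentiable
at EVERY state `(δ, ω)` with derivative `jacCLM δ`** (= `jacMatrix δ`, `jacCLM_eq_mulVec`); the
Jacobian depends on the angles only. Via `DroopMicrogrid.freqField_eq_field` the same holds for the
frozen-voltage droop microgrid (`DroopMicrogrid.hasFDerivAt_freqField`). MODELLED: MV-2 (classical) /
MV-6N (droop, frozen voltages). [folklore] -/
theorem hasFDerivAt_field (x : State n) : HasFDerivAt p.field (p.jacCLM x.1) x := by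
  have hfst : HasFDerivAt (fun y : State n => y.1) (ContinuousLinearMap.fst ℝ _ _) x := hasFDerivAt_fst
  have hsnd : HasFDerivAt (fun y : State n => y.2) (ContinuousLinearMap.snd ℝ _ _) x := hasFDerivAt_snd
  have hπ : ∀ i j : Fin n, HasFDerivAt (fun y : State n => y.1 i - y.1 j) (lineCLM i j) x := by
    intro i j
    have hi := (hasFDerivAt_apply (𝕜 := ℝ) i x.1).comp x hfst
    have hj := (hasFDerivAt_apply (𝕜 := ℝ) j x.1).comp x hfst
    refine (hi.sub hj).congr_fderiv ?_
    ext v <;> simp [lineCLM]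
  have h2 : ∀ i : Fin n, HasFDerivAt (fun y : State n => y.2 i) (speedCLM i) x := by
    intro i
    refine ((hasFDerivAt_apply (𝕜 := ℝ) i x.2).comp x hsnd).congr_fderiv ?_
    ext v <;> simp [speedCLM]
  have hPe : ∀ i : Fin n, HasFDerivAt (fun y : State n => p.Pe y.1 i) (p.PeFDeriv x.1 i) x := by
    intro i
    unfold Pe PeFDeriv
    exact (HasFDerivAt.fun_sum fun j _ =>
      (((Real.hasDerivAt_sin _).comp_hasFDerivAt x (hπ i j)).const_mul (p.Ccoef i j)).add
        (((Real.hasDerivAt_cos _).comp_hasFDerivAt x (hπ i j)).const_mul (p.Dcoef i j))).const_add _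
  have hfield : p.field = fun y : State n =>
      (y.2, fun i => (p.P i - p.Pe y.1 i - p.D i * y.2 i) * (p.M i)⁻¹) := by
    funext y
    simp only [field, div_eq_mul_inv]
  rw [hfield]
  refine hsnd.prodMk (hasFDerivAt_pi.2 fun i => ?_)
  have h := (((hPe i).const_sub (p.P i)).sub ((h2 i).const_mul (p.D i))).mul_const (p.M i)⁻¹
  refine h.congr_fderiv ?_
  ext v <;> simp [sub_eq_add_neg]

/-! ## §2 Uniform damping ratio: the certified small-signal decay rate of the network model -/

/-- Over `ℂ`, the `A`-block acts as `M⁻¹` times `L(δ)`. [folklore] -/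
theorem Ablock_map_mulVec (δ : Fin n → ℝ) (x : Fin n → ℂ) (i : Fin n) :
    ((p.Ablock δ).map ((↑) : ℝ → ℂ) *ᵥ x) i
      = ((p.M i)⁻¹ : ℝ) * ((p.PeJac δ).map ((↑) : ℝ → ℂ) *ᵥ x) i := by
  simp only [map_ofReal_mulVec_apply, Ablock, Finset.mul_sum]
  refine Finset.sum_congr rfl fun j _ => ?_
  push_cast
  ring

/-- Roots of `z² + d z + μ` with NEGATIVE discriminant (`d² < 4μ`, real `d, μ`) have real part EXACTLY
`−d/2` (a complex-conjugate pair): the underdamped regime. [folklore] -/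
theorem _root_.Summit.Ventures.GridStability.Models.quadratic_re_eq_of_discr_neg {d μ : ℝ}
    (h : d ^ 2 < 4 * μ) {z : ℂ} (hz : z ^ 2 + (d : ℂ) * z + (μ : ℂ) = 0) : z.re = -(d / 2) := by
  have hre := congr_arg Complex.re hz
  have him := congr_arg Complex.im hz
  simp only [Complex.add_re, Complex.add_im, Complex.mul_re, Complex.mul_im, Complex.ofReal_re,
    Complex.ofReal_im, Complex.zero_re, Complex.zero_im, sq, zero_mul, sub_zero, add_zero] at hre him
  -- him : 2 re·im + d·im = 0 ;  hre : re² − im² + d re + μ = 0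
  have hb : z.im * (2 * z.re + d) = 0 := by linear_combination him
  rcases mul_eq_zero.1 hb with hb0 | hb0
  · exfalso
    rw [hb0] at hre
    nlinarith [sq_nonneg (2 * z.re + d)]
  · linarith

/-- **The decoupled mode equation.** Uniform damping ratio (`D_i = d·M_i`, `M_i > 0`), lossless reciprocal
network, pencil certificate `L(δ) − ν₀·diag(M) + β·(M Mᵀ) ≻ 0`: every eigenpair `(z, [x; y])` of `J(δ)` is
either SYNCHRONOUS (`L(δ) x = 0`) or satisfies `z² + d z + μ = 0` for a REAL `μ > ν₀` (a pencil eigenvalue).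
[folklore] -/
theorem eig_quadratic_of_uniformDamping (hM : ∀ i, 0 < p.M i) {d : ℝ} (hD : ∀ i, p.D i = d * p.M i)
    (hG : p.IsLossless) (hB : ∀ i j, p.B i j = p.B j i) (δ : Fin n → ℝ) {ν₀ β : ℝ}
    (hS : (p.PeJac δ - ν₀ • Matrix.diagonal p.M + β • Matrix.vecMulVec p.M p.M).PosDef)
    {z : ℂ} {w : Fin n ⊕ Fin n → ℂ} (hw : w ≠ 0)
    (hJ : (p.jacMatrix δ).map ((↑) : ℝ → ℂ) *ᵥ w = z • w) :
    (p.PeJac δ).map ((↑) : ℝ → ℂ) *ᵥ (w ∘ Sum.inl) = 0 ∨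
      ∃ μ : ℝ, ν₀ < μ ∧ z ^ 2 + (d : ℂ) * z + (μ : ℂ) = 0 := by
  have hM' : ∀ i, p.M i ≠ 0 := fun i => (hM i).ne'
  rw [p.jacMatrix_eq_secondOrderJac hD hM' δ, secondOrderJac_map_ofReal] at hJ
  have hx := secondOrderJac_eig_fst_ne_zero hJ hw
  have hA := ((secondOrderJac_eig_iff _ _ z w).1 hJ).2
  set μ : ℂ := -(z ^ 2 + (d : ℂ) * z) with hμdef
  have hAμ : (p.Ablock δ).map ((↑) : ℝ → ℂ) *ᵥ (w ∘ Sum.inl) = μ • (w ∘ Sum.inl) := by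
    rw [hA, hμdef, neg_smul]
  -- the pencil form `L x = μ M x`
  have hLx : (p.PeJac δ).map ((↑) : ℝ → ℂ) *ᵥ (w ∘ Sum.inl)
      = μ • fun i => (p.M i : ℂ) * (w ∘ Sum.inl) i := by
    funext i
    have h := congr_fun hAμ i
    rw [Ablock_map_mulVec] at h
    simp only [Pi.smul_apply, smul_eq_mul] at h ⊢
    have key : ((p.PeJac δ).map ((↑) : ℝ → ℂ) *ᵥ (w ∘ Sum.inl)) i
        = ((p.M i : ℝ) : ℂ) * ((((p.M i)⁻¹ : ℝ) : ℂ)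
          * ((p.PeJac δ).map ((↑) : ℝ → ℂ) *ᵥ (w ∘ Sum.inl)) i) := by
      rw [← mul_assoc, ← Complex.ofReal_mul, mul_inv_cancel₀ (hM' i), Complex.ofReal_one, one_mul]
    rw [key, h]
    ring
  rcases pencil_eig_real_gt hM (p.PeJac_colsum hG hB δ) hS hx hLx with h0 | ⟨him, hre⟩
  · left
    rw [hLx, h0, zero_smul]
  · right
    refine ⟨μ.re, hre, ?_⟩
    have hμre : (μ.re : ℂ) = μ := Complex.ext (by simp) (by simp [him])
    rw [hμre, hμdef]
    ring

/-- **Certified small-signal decay rate for the classical network-reduced model with UNIFORM damping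
ratio (`D_i = d·M_i`, `M_i > 0`), lossless reciprocal network, at any angle configuration `δ`.** If the
`n × n` real symmetric matrix `L(δ) − ν₀·diag(M) + β·(M Mᵀ)` is positive definite (one exact PSD
certificate) and `d > 2r`, `ν₀ − d r + r² > 0`, then every eigenpair `(z, [x; y])` of the Jacobian
`J(δ)` (complex) either belongs to the SYNCHRONOUS mode (`L(δ) x = 0`; then `z ∈ {0, −d}`,
`eig_sync_of_uniformDamping`) or has `Re z < −r`. CERTIFIED: a statement about the matrix `J(δ)`;
MODELLED: MV-2L + MV-λ [cite: SauerPai1998, §6.10]; [cite: HairerNorsettWanner1993, §I.13 Theorem 13.4].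
No sentence here says a grid is stable. -/
theorem eig_re_lt_neg_of_uniformDamping (hM : ∀ i, 0 < p.M i) {d : ℝ} (hD : ∀ i, p.D i = d * p.M i)
    (hG : p.IsLossless) (hB : ∀ i j, p.B i j = p.B j i) (δ : Fin n → ℝ) {ν₀ β r : ℝ}
    (hS : (p.PeJac δ - ν₀ • Matrix.diagonal p.M + β • Matrix.vecMulVec p.M p.M).PosDef)
    (hd : 0 < d - 2 * r) (hν : 0 < ν₀ - d * r + r ^ 2)
    {z : ℂ} {w : Fin n ⊕ Fin n → ℂ} (hw : w ≠ 0)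
    (hJ : (p.jacMatrix δ).map ((↑) : ℝ → ℂ) *ᵥ w = z • w) :
    (p.PeJac δ).map ((↑) : ℝ → ℂ) *ᵥ (w ∘ Sum.inl) = 0 ∨ z.re < -r := by
  rcases p.eig_quadratic_of_uniformDamping hM hD hG hB δ hS hw hJ with h0 | ⟨μ, hμ, hq⟩
  · exact Or.inl h0
  · exact Or.inr ((quadratic_re_lt_neg_iff d μ r).2 ⟨hd, by linarith⟩ z hq)

/-- **Underdamped regime: every non-synchronous mode decays at rate EXACTLY `d/2`.** Same hypotheses with
the certificate level `ν₀ ≥ d²/4`: every eigenpair of `J(δ)` off the synchronous mode has `Re z = −d/2`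
(all electromechanical modes of a uniformly damped lossless model share one decay rate; the pencil
eigenvalues only set the oscillation frequencies). CERTIFIED: about the matrix `J(δ)`; MODELLED: MV-2L + MV-λ.
No stability sentence. [folklore] -/
theorem eig_re_eq_of_uniformDamping (hM : ∀ i, 0 < p.M i) {d : ℝ} (hD : ∀ i, p.D i = d * p.M i)
    (hG : p.IsLossless) (hB : ∀ i j, p.B i j = p.B j i) (δ : Fin n → ℝ) {ν₀ β : ℝ}
    (hS : (p.PeJac δ - ν₀ • Matrix.diagonal p.M + β • Matrix.vecMulVec p.M p.M).PosDef)
    (hν : d ^ 2 ≤ 4 * ν₀) {z : ℂ} {w : Fin n ⊕ Fin n → ℂ} (hw : w ≠ 0)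
    (hJ : (p.jacMatrix δ).map ((↑) : ℝ → ℂ) *ᵥ w = z • w) :
    (p.PeJac δ).map ((↑) : ℝ → ℂ) *ᵥ (w ∘ Sum.inl) = 0 ∨ z.re = -(d / 2) := by
  rcases p.eig_quadratic_of_uniformDamping hM hD hG hB δ hS hw hJ with h0 | ⟨μ, hμ, hq⟩
  · exact Or.inl h0
  · exact Or.inr (quadratic_re_eq_of_discr_neg (by linarith) hq)

/-- **The synchronous mode** of the uniformly damped model: an eigenpair whose angle part is annihilated
by `L(δ)` has `z = 0` (the rotational symmetry) or `z = −d`. [folklore] -/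
theorem eig_sync_of_uniformDamping {d : ℝ} (hD : ∀ i, p.D i = d * p.M i) (hM : ∀ i, p.M i ≠ 0)
    (δ : Fin n → ℝ) {z : ℂ} {w : Fin n ⊕ Fin n → ℂ} (hw : w ≠ 0)
    (hJ : (p.jacMatrix δ).map ((↑) : ℝ → ℂ) *ᵥ w = z • w)
    (hL : (p.PeJac δ).map ((↑) : ℝ → ℂ) *ᵥ (w ∘ Sum.inl) = 0) : z = 0 ∨ z = -d := by
  rw [p.jacMatrix_eq_secondOrderJac hD hM δ, secondOrderJac_map_ofReal] at hJ
  have hA : (p.Ablock δ).map ((↑) : ℝ → ℂ) *ᵥ (w ∘ Sum.inl) = 0 := by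
    funext i
    rw [Ablock_map_mulVec, hL]
    simp
  rcases secondOrderJac_eig_sync hJ hw hA with h | h
  · exact Or.inl h
  · exact Or.inr (by rw [h])

end ClassicalSwing

/-! ## §3 Reading on the droop-inverter microgrid with a common power-filter time constant -/

namespace DroopMicrogrid

variable {n : ℕ} (mg : DroopMicrogrid n)

/-- **Linearisation of the frozen-voltage droop microgrid** (model N2): at every state the field
`freqField V` has Fréchet derivative `(toClassicalSwing V).jacCLM δ` (kernel identity
`freqField_eq_field` + `ClassicalSwing.hasFDerivAt_field`). MODELLED: MV-6N [cite: KunduEtAl2019,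
eqs. (4a)–(4b), (5a)] [cite: SchifferEtAl2014, Remark 3.3]. -/
theorem hasFDerivAt_freqField (hk : ∀ i, mg.kP i ≠ 0) (hτ : ∀ i, mg.τP i ≠ 0) (V : Fin n → ℝ)
    (x : ClassicalSwing.State n) :
    HasFDerivAt (mg.freqField V) ((mg.toClassicalSwing V).jacCLM x.1) x := by
  have h : mg.freqField V = (mg.toClassicalSwing V).field := funext (mg.freqField_eq_field hk hτ V)
  rw [h]
  exact (mg.toClassicalSwing V).hasFDerivAt_field x

/-- **Certified small-signal decay rate for an `n`-unit lossless droop microgrid with a COMMON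
power-filter time constant `τ` (frozen voltages `V`), at any angle configuration `δ`.** With virtual
inertias `M_i = τ/λ^p_i` the damping ratio is uniform, `d = 1/τ`
(`toClassicalSwing_uniformDamping`); if `L(δ) − ν₀·diag(M) + β·(M Mᵀ)` is positive definite and
`1/τ > 2r`, `ν₀ − r/τ + r² > 0`, every eigenpair of the Jacobian off the synchronous mode has
`Re z < −r`. One `n × n` exact PSD check, no SDP, any `n` — the solver-free small-signal lane of the
apex line; LEVER: common `τ`; CEILING: heterogeneous filters / voltage loop / lossy lines (file header).
CERTIFIED: about the matrix `J(δ)` of the MODEL; MODELLED: MV-6N + lossless reciprocal network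
[cite: KunduEtAl2019, eqs. (4a)–(4b), (5a)] [cite: SchifferEtAl2014, Remark 3.3]. No sentence here says
a microgrid is stable. -/
theorem eig_re_lt_neg_of_commonFilter (hk : ∀ i, 0 < mg.kP i) {τ : ℝ} (hτ0 : 0 < τ)
    (hτ : ∀ i, mg.τP i = τ) (hG : ∀ i j, i ≠ j → mg.G i j = 0) (hB : ∀ i j, mg.B i j = mg.B j i)
    (V δ : Fin n → ℝ) {ν₀ β r : ℝ}
    (hS : ((mg.toClassicalSwing V).PeJac δ - ν₀ • Matrix.diagonal (mg.toClassicalSwing V).M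
      + β • Matrix.vecMulVec (mg.toClassicalSwing V).M (mg.toClassicalSwing V).M).PosDef)
    (hd : 0 < 1 / τ - 2 * r) (hν : 0 < ν₀ - 1 / τ * r + r ^ 2)
    {z : ℂ} {w : Fin n ⊕ Fin n → ℂ} (hw : w ≠ 0)
    (hJ : ((mg.toClassicalSwing V).jacMatrix δ).map ((↑) : ℝ → ℂ) *ᵥ w = z • w) :
    ((mg.toClassicalSwing V).PeJac δ).map ((↑) : ℝ → ℂ) *ᵥ (w ∘ Sum.inl) = 0 ∨ z.re < -r := by
  have hk' : ∀ i, mg.kP i ≠ 0 := fun i => (hk i).ne'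
  have hM : ∀ i, 0 < (mg.toClassicalSwing V).M i := fun i => by
    simp only [toClassicalSwing, hτ i]
    exact div_pos hτ0 (hk i)
  exact (mg.toClassicalSwing V).eig_re_lt_neg_of_uniformDamping hM
    (mg.toClassicalSwing_uniformDamping hk' hτ0.ne' hτ V) hG hB δ hS hd hν hw hJ

end DroopMicrogrid

end Summit.Ventures.GridStability.Models

end
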